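import Summits.AtomisticToContinuum.BoseEinsteinCondensation.Theorems.HardCoreExtension.Negative.BiWaveParseval

/-!
# Negative lemmas for crux `HardCoreExtension` (stmt-AtomisticToContinuum-11786) — line
# `third-law-current-floor`, stub S1 `stub_secondMomentFloor`, II: THE REALITY HYPOTHESIS IS LOAD-BEARING

Supports (does not close) stmt-AtomisticToContinuum-11786 (route `BECConjugateDomination`); drefute
seat on the picked line `Cruxes/HardCoreExtension/Lines/third-law-current-floor.lean`.

Stub S1 is the exact second-moment floor `((n+1)K)² ≤ ((n+1)S)(4D + (n+1)K²(2 − S))` for every REAL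
periodic `C¹` Bose state (`K = |k|²`, `S` the structure-factor integral, `D` the force-structure
integral), i.e. Cauchy–Schwarz applied to `Re⟨ρ_kΨ, [H,ρ_k]Ψ⟩ = (n+1)K` and
`‖[H,ρ_k]Ψ‖² = 4D + (n+1)K²(2−S)`; both identities use `Ψ∇Ψ = ∇(Ψ²)/2`.  Here:

* `SecondMomentFloorWithoutReality` (S1 with the reality hypothesis deleted) is FALSE
  (`not_secondMomentFloorWithoutReality`), while it implies the stub as typed
  (`secondMomentFloorExact_of_withoutReality`), which is NOT refuted.
* Witness (`boostState`, `N = 2`, any `L > 0`, mode `e₀`): the Galilean boost of the real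
  anti-correlated pair state,
  `Ψ = c·(e_{−e₀}(x₀)e_{−e₀}(x₁) − ½e_{−2e₀}(x₀) − ½e_{−2e₀}(x₁)) = c e^{−ik·(x₀+x₁)}(1 − cos k·(x₀−x₁))`,
  `c² = 2/(3L⁶)`.  Its longitudinal current sum VANISHES IDENTICALLY,
  `e_{e₀}(x₀)(k·∇₀)Ψ + e_{e₀}(x₁)(k·∇₁)Ψ ≡ 0` (`forceSum_boostFun`), so `D = 0`, while
  `(e_{e₀}(x₀)+e_{e₀}(x₁))Ψ` is a combination of four orthogonal two-body plane waves of equal weight,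
  so `∫|ρ_kΨ|² = 2/3` (`S = ⅓`, `structureIntegral_boostFun`); the typed inequality then reads
  `4K² ≤ (2/3)·(10K²/3) = 20K²/9` — false.  In general every complex state with vanishing current sum
  and `S ≠ 1` violates the reality-free form (its right/left ratio is `S(2 − S) < 1`), so any proof of
  S1 must pass through `∇(Ψ²) = 2Ψ∇Ψ`.
* Toolkit in file I (`BiWaveParseval`): `biWave`, `integral_norm_sq_sum_biWave` (finite Parseval on
  `cell²`), `kvec`, `cellWaveProjDeriv_apply_single` (partial derivatives of `X ↦ e_p(x_j)`).
-/

noncomputable section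

open MeasureTheory Filter Set
open scoped ENNReal NNReal Topology ComplexConjugate BigOperators

namespace Summit.AtomisticToContinuum.BoseEinsteinCondensation.Theorems.HardCoreExtension.Negative

open Literature.MathematicalPhysics.QuantumManyBody.BoseGas
open Summit.AtomisticToContinuum.BoseEinsteinCondensation.Theorems.GaussianDominationCan.Negative
  (integral_cellN_prod integral_cell_const)
open Summit.AtomisticToContinuum.BoseEinsteinCondensation.Theorems.CorrectorClosure.Negative
  (e0 e0_ne_zero)

variable {L : ℝ}

/-! ## The witness: a boosted anti-correlated pair state (`N = 2`) -/

/-- The normalisation `c = (3L⁶/2)^{-1/2}`. -/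
def bnorm (L : ℝ) : ℝ := (Real.sqrt (3 / 2 * L ^ 6))⁻¹

/-- `c > 0`. [folklore] -/
theorem bnorm_pos (hL : 0 < L) : 0 < bnorm L := by
  unfold bnorm
  exact inv_pos.mpr (Real.sqrt_pos.mpr (by positivity))

/-- `c² · (3L⁶/2) = 1`. [folklore] -/
theorem bnorm_sq (hL : 0 < L) : bnorm L ^ 2 * (3 / 2 * L ^ 6) = 1 := by
  unfold bnorm
  have h : (0 : ℝ) < 3 / 2 * L ^ 6 := by positivity
  rw [inv_pow, Real.sq_sqrt h.le, inv_mul_cancel₀ h.ne']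

/-- **The witness wave function** `Ψ = c·(e_{−e₀}(x₀)e_{−e₀}(x₁) − ½e_{−2e₀}(x₀) − ½e_{−2e₀}(x₁))`
(`= c e^{−ik·(x₀+x₁)}(1 − cos k·(x₀−x₁))`). -/
def boostFun (L : ℝ) (X : Config 2) : ℂ :=
  (bnorm L : ℂ) * (cellWave L (-e0) (X 0) * cellWave L (-e0) (X 1)
    - (1 / 2 : ℂ) * cellWave L (-e0 + -e0) (X 0) - (1 / 2 : ℂ) * cellWave L (-e0 + -e0) (X 1))

/-- `Ψ` is continuous. [folklore] -/
@[fun_prop]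
theorem continuous_boostFun (L : ℝ) : Continuous (boostFun L) := by
  unfold boostFun; fun_prop

/-- `Ψ` is `C¹`. [folklore] -/
theorem contDiff_boostFun (L : ℝ) : ContDiff ℝ 1 (boostFun L) := by
  have hcw : ∀ (p : Fin 3 → ℤ) (j : Fin 2), ContDiff ℝ 1 (fun X : Config 2 => cellWave L p (X j)) :=
    fun p j => ((contDiff_cellWave L p).of_le (mod_cast le_top)).comp (contDiff_apply ℝ Space j)
  unfold boostFun
  exact contDiff_const.mul ((((hcw _ 0).mul (hcw _ 1)).sub (contDiff_const.mul (hcw _ 0))).sub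
    (contDiff_const.mul (hcw _ 1)))

/-- `Ψ` is symmetric under the swap of the two particles (as an expression). [folklore] -/
theorem boostFun_swap_args (L : ℝ) (X : Config 2) (σ : Equiv.Perm (Fin 2)) :
    boostFun L (X ∘ σ) = boostFun L X := by
  have hσ : σ = 1 ∨ σ = Equiv.swap 0 1 := by
    rcases Fin.exists_fin_two.mp ⟨σ 0, rfl⟩ with h | h
    · left
      ext i
      have key : ∀ x : Fin 2, x ≠ 0 → x = 1 := by decide
      fin_cases i
      · simp [h]
      · have h1 : σ 1 ≠ 0 := fun e => absurd (σ.injective (e.trans h.symm)) (by decide)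
        simp [key _ h1]
    · right
      ext i
      have key : ∀ x : Fin 2, x ≠ 1 → x = 0 := by decide
      fin_cases i
      · simp [h]
      · have h1 : σ 1 ≠ 1 := fun e => absurd (σ.injective (e.trans h.symm)) (by decide)
        simp [key _ h1]
  rcases hσ with rfl | rfl
  · rfl
  · unfold boostFun
    simp only [Function.comp_apply, Equiv.swap_apply_left, Equiv.swap_apply_right]
    ring

/-- The momenta and amplitudes of `Ψ` as a combination of two-body plane waves. -/
def P3 : Fin 3 → (Fin 3 → ℤ) × (Fin 3 → ℤ)
  | 0 => (-e0, -e0)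
  | 1 => (-e0 + -e0, 0)
  | 2 => (0, -e0 + -e0)

/-- The amplitudes `(c, −c/2, −c/2)`. -/
def A3 (L : ℝ) : Fin 3 → ℂ
  | 0 => (bnorm L : ℂ)
  | 1 => -((bnorm L : ℂ) / 2)
  | 2 => -((bnorm L : ℂ) / 2)

/-- `Ψ = ∑ᵢ A3ᵢ · biWave(P3ᵢ)`. [folklore] -/
theorem boostFun_eq_sum (L : ℝ) (X : Config 2) :
    boostFun L X = ∑ i : Fin 3, A3 L i * biWave L (P3 i).1 (P3 i).2 X := by
  rw [Fin.sum_univ_three, show A3 L 0 = (bnorm L : ℂ) from rfl,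
    show A3 L 1 = -((bnorm L : ℂ) / 2) from rfl, show A3 L 2 = -((bnorm L : ℂ) / 2) from rfl,
    show P3 0 = (-e0, -e0) from rfl, show P3 1 = (-e0 + -e0, 0) from rfl,
    show P3 2 = (0, -e0 + -e0) from rfl]
  unfold biWave boostFun
  rw [cellWave_zero, cellWave_zero]
  ring

/-- The three momenta of `Ψ` are distinct. [folklore] -/
theorem P3_injective : Function.Injective P3 := by
  unfold P3 e0
  decide

/-- `∫_{cell²} |Ψ|² = 1`. [folklore] -/
theorem integral_norm_sq_boostFun (hL : 0 < L) : ∫ X in cellN 2 L, ‖boostFun L X‖ ^ 2 = 1 := by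
  simp_rw [boostFun_eq_sum]
  rw [integral_norm_sq_sum_biWave hL (A3 L) P3 P3_injective]
  have hb := bnorm_sq hL
  have hb0 := (bnorm_pos hL).le
  rw [Fin.sum_univ_three, show A3 L 0 = (bnorm L : ℂ) from rfl,
    show A3 L 1 = -((bnorm L : ℂ) / 2) from rfl, show A3 L 2 = -((bnorm L : ℂ) / 2) from rfl,
    norm_neg, norm_div, Complex.norm_real, Real.norm_of_nonneg hb0, Complex.norm_ofNat]
  nlinarith [hb]

/-- **The witness state** `boostState` (`N = 2`, side `L > 0`). -/
def boostState (hL : 0 < L) : PeriodicTrialState 2 L where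
  ψ := boostFun L
  contDiff := contDiff_boostFun L
  periodic X i k := by
    unfold boostFun
    fin_cases i <;>
      simp [cellWave_periodic hL.ne']
  symm σ X := boostFun_swap_args L X σ
  norm_eq := by
    have hint : Integrable (fun X => ‖boostFun L X‖ ^ 2) (volume.restrict (cellN 2 L)) :=
      integrableOn_cellN ((continuous_boostFun L).norm.pow 2) L
    simp_rw [coe_nnnorm_sq_eq_ofReal]
    rw [← ofReal_integral_eq_lintegral_ofReal hint (Eventually.of_forall fun X => by positivity),
      integral_norm_sq_boostFun hL, ENNReal.ofReal_one]

/-- The wave function of `boostState`. [folklore] -/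
@[simp] theorem boostState_ψ (hL : 0 < L) : (boostState hL).ψ = boostFun L := rfl

/-! ## `ρ_kΨ`: four orthogonal two-body plane waves of weight `c/2`, so `∫|ρ_kΨ|² = 2/3` -/

/-- The momenta of `(e_{e₀}(x₀) + e_{e₀}(x₁))Ψ`. -/
def Q4 : Fin 4 → (Fin 3 → ℤ) × (Fin 3 → ℤ)
  | 0 => (0, -e0)
  | 1 => (-e0, 0)
  | 2 => (-e0 + -e0, e0)
  | 3 => (e0, -e0 + -e0)

/-- The amplitudes `(c/2, c/2, −c/2, −c/2)`. -/
def B4 (L : ℝ) : Fin 4 → ℂ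
  | 0 => (bnorm L : ℂ) / 2
  | 1 => (bnorm L : ℂ) / 2
  | 2 => -((bnorm L : ℂ) / 2)
  | 3 => -((bnorm L : ℂ) / 2)

/-- `e_{e₀} e_{−e₀} = 1`. -/
theorem cellWave_e0_mul_neg (L : ℝ) (x : Space) : cellWave L e0 x * cellWave L (-e0) x = 1 := by
  rw [← cellWave_add_index, add_neg_cancel, cellWave_zero]

/-- `e_{e₀} e_{−2e₀} = e_{−e₀}`. -/
theorem cellWave_e0_mul_neg_two (L : ℝ) (x : Space) :
    cellWave L e0 x * cellWave L (-e0 + -e0) x = cellWave L (-e0) x := by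
  rw [← cellWave_add_index, ← add_assoc, add_neg_cancel, zero_add]

/-- **`ρ_kΨ` as four orthogonal plane waves**:
`(e_{e₀}(x₀) + e_{e₀}(x₁))Ψ = (c/2)(e_{−e₀}(x₁) + e_{−e₀}(x₀) − e_{−2e₀}(x₀)e_{e₀}(x₁) − e_{e₀}(x₀)e_{−2e₀}(x₁))`. -/
theorem rho_mul_boostFun (L : ℝ) (X : Config 2) :
    (cellWave L e0 (X 0) + cellWave L e0 (X 1)) * boostFun L X =
      ∑ i : Fin 4, B4 L i * biWave L (Q4 i).1 (Q4 i).2 X := by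
  have h10 := cellWave_e0_mul_neg L (X 0)
  have h11 := cellWave_e0_mul_neg L (X 1)
  have h20 := cellWave_e0_mul_neg_two L (X 0)
  have h21 := cellWave_e0_mul_neg_two L (X 1)
  rw [Fin.sum_univ_four, show B4 L 0 = (bnorm L : ℂ) / 2 from rfl, show B4 L 1 = (bnorm L : ℂ) / 2 from rfl,
    show B4 L 2 = -((bnorm L : ℂ) / 2) from rfl, show B4 L 3 = -((bnorm L : ℂ) / 2) from rfl,
    show Q4 0 = (0, -e0) from rfl, show Q4 1 = (-e0, 0) from rfl, show Q4 2 = (-e0 + -e0, e0) from rfl,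
    show Q4 3 = (e0, -e0 + -e0) from rfl]
  unfold biWave boostFun
  rw [cellWave_zero, cellWave_zero]
  linear_combination ((bnorm L : ℂ) * cellWave L (-e0) (X 1)) * h10
    + ((bnorm L : ℂ) * cellWave L (-e0) (X 0)) * h11
    - ((bnorm L : ℂ) / 2) * h20 - ((bnorm L : ℂ) / 2) * h21

/-- The four momenta of `ρ_kΨ` are distinct. -/
theorem Q4_injective : Function.Injective Q4 := by
  unfold Q4 e0
  decide

/-- **The structure-factor integral of the witness**: `∫ |e_{e₀}(x₀)+e_{e₀}(x₁)|² |Ψ|² = 2/3`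
(`S = ⅓` for `N = 2`). -/
theorem structureIntegral_boostFun (hL : 0 < L) :
    ∫ X in cellN 2 L, ‖∑ j : Fin 2, cellWave L e0 (X j)‖ ^ 2 * ‖boostFun L X‖ ^ 2 = 2 / 3 := by
  have hpt : ∀ X : Config 2, ‖∑ j : Fin 2, cellWave L e0 (X j)‖ ^ 2 * ‖boostFun L X‖ ^ 2 =
      ‖∑ i : Fin 4, B4 L i * biWave L (Q4 i).1 (Q4 i).2 X‖ ^ 2 := fun X => by
    rw [← rho_mul_boostFun, norm_mul, mul_pow, Fin.sum_univ_two]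
  simp_rw [hpt]
  rw [integral_norm_sq_sum_biWave hL (B4 L) Q4 Q4_injective]
  have hb := bnorm_sq hL
  have hb0 := (bnorm_pos hL).le
  rw [Fin.sum_univ_four, show B4 L 0 = (bnorm L : ℂ) / 2 from rfl, show B4 L 1 = (bnorm L : ℂ) / 2 from rfl,
    show B4 L 2 = -((bnorm L : ℂ) / 2) from rfl, show B4 L 3 = -((bnorm L : ℂ) / 2) from rfl,
    norm_neg, norm_div, Complex.norm_real, Real.norm_of_nonneg hb0, Complex.norm_ofNat]
  nlinarith [hb]

/-! ## The longitudinal current sum of the witness vanishes identically (`D = 0`) -/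

/-- The derivative of `Ψ`. -/
theorem hasFDerivAt_boostFun (L : ℝ) (X : Config 2) :
    HasFDerivAt (boostFun L)
      ((bnorm L : ℂ) • ((cellWave L (-e0) (X 0) • cellWaveProjDeriv L (-e0) 1 X +
          cellWave L (-e0) (X 1) • cellWaveProjDeriv L (-e0) 0 X) -
        (1 / 2 : ℂ) • cellWaveProjDeriv L (-e0 + -e0) 0 X -
        (1 / 2 : ℂ) • cellWaveProjDeriv L (-e0 + -e0) 1 X)) X := by
  have h00 := hasFDerivAt_cellWave_proj L (-e0) 0 X
  have h01 := hasFDerivAt_cellWave_proj L (-e0) 1 X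
  have h20 := hasFDerivAt_cellWave_proj L (-e0 + -e0) 0 X
  have h21 := hasFDerivAt_cellWave_proj L (-e0 + -e0) 1 X
  exact (((h00.mul h01).sub (h20.const_mul (1 / 2 : ℂ))).sub (h21.const_mul (1 / 2 : ℂ))).const_mul
    (bnorm L : ℂ)

/-- `(−e₀)₀ = −1`. -/
theorem neg_e0_zero : (-e0) 0 = -1 := by simp [e0]

/-- `(−2e₀)₀ = −2`. -/
theorem neg_two_e0_zero : (-e0 + -e0) 0 = -2 := by norm_num [e0]

/-- **The current sum of the witness vanishes**: `e_{e₀}(x₀)(k·∇₀)Ψ + e_{e₀}(x₁)(k·∇₁)Ψ = 0` at every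
configuration (the boost's current cancels the anti-correlated pair's force). -/
theorem forceSum_boostFun (L : ℝ) (X : Config 2) :
    ∑ j : Fin 2, cellWave L e0 (X j) * fderiv ℝ (boostFun L) X (Pi.single j (kvec L)) = 0 := by
  rw [(hasFDerivAt_boostFun L X).fderiv]
  have h10 := cellWave_e0_mul_neg L (X 0)
  have h11 := cellWave_e0_mul_neg L (X 1)
  have h20 := cellWave_e0_mul_neg_two L (X 0)
  have h21 := cellWave_e0_mul_neg_two L (X 1)
  simp only [Fin.sum_univ_two, smul_apply, sub_apply, add_apply, cellWaveProjDeriv_apply_single,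
    sum_mul_kvec, neg_e0_zero, neg_two_e0_zero, if_true, if_false, show ¬ ((0 : Fin 2) = 1) from by decide,
    show ¬ ((1 : Fin 2) = 0) from by decide, smul_eq_mul, mul_zero, add_zero, zero_add, sub_zero]
  push_cast
  linear_combination ((bnorm L : ℂ) * ((2 * (Real.pi : ℂ) * Complex.I / (L : ℂ)) *
      (2 * (Real.pi : ℂ) / (L : ℂ)))) *
    (-(cellWave L (-e0) (X 1) * h10) + h20 - cellWave L (-e0) (X 0) * h11 + h21)

/-- **`D = 0` for the witness.** -/
theorem forceStructure_boostFun (L : ℝ) :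
    ∫ X in cellN 2 L, ‖∑ j : Fin 2, cellWave L e0 (X j) *
        fderiv ℝ (boostFun L) X (Pi.single j (kvec L))‖ ^ 2 = 0 := by
  simp_rw [forceSum_boostFun]
  simp


/-! ## The statements: S1 as typed, and S1 without the reality hypothesis -/

/-- Stub S1 `stub_secondMomentFloor` of `Cruxes/HardCoreExtension/Lines/third-law-current-floor.lean`,
VERBATIM (real states).  Recorded only to certify that the refuted statement below is a strengthening of
it (`secondMomentFloorExact_of_withoutReality`); it is NOT refuted here (it is TRUE on paper). -/
def SecondMomentFloorExact : Prop :=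
  ∀ (n : ℕ) (L : ℝ), 0 < L → ∀ Ψ : PeriodicTrialState (n + 1) L,
    (∀ X, Ψ.ψ X = (((Ψ.ψ X).re : ℝ) : ℂ)) →
    ∀ m : Fin 3 → ℤ, m ≠ 0 →
      (((n : ℝ) + 1) * ‖(2 * Real.pi / L) • latticeVec 1 m‖ ^ 2) ^ 2 ≤
        (((n : ℝ) + 1) *
            (((n : ℝ) + 1)⁻¹ *
              ∫ X in cellN (n + 1) L,
                ‖∑ j : Fin (n + 1), cellWave L m (X j)‖ ^ 2 * ‖Ψ.ψ X‖ ^ 2)) *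
          (4 * (∫ X in cellN (n + 1) L,
                  ‖∑ j : Fin (n + 1), cellWave L m (X j) *
                      fderiv ℝ Ψ.ψ X (Pi.single j ((2 * Real.pi / L) • latticeVec 1 m))‖ ^ 2) +
            ((n : ℝ) + 1) * ‖(2 * Real.pi / L) • latticeVec 1 m‖ ^ 4 *
              (2 - ((n : ℝ) + 1)⁻¹ *
                ∫ X in cellN (n + 1) L,
                  ‖∑ j : Fin (n + 1), cellWave L m (X j)‖ ^ 2 * ‖Ψ.ψ X‖ ^ 2))

/-- S1 with the reality hypothesis `∀ X, Ψ X = Re Ψ X` DELETED (every periodic `C¹` Bose state).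
FALSE (`not_secondMomentFloorWithoutReality`). -/
def SecondMomentFloorWithoutReality : Prop :=
  ∀ (n : ℕ) (L : ℝ), 0 < L → ∀ Ψ : PeriodicTrialState (n + 1) L,
    ∀ m : Fin 3 → ℤ, m ≠ 0 →
      (((n : ℝ) + 1) * ‖(2 * Real.pi / L) • latticeVec 1 m‖ ^ 2) ^ 2 ≤
        (((n : ℝ) + 1) *
            (((n : ℝ) + 1)⁻¹ *
              ∫ X in cellN (n + 1) L,
                ‖∑ j : Fin (n + 1), cellWave L m (X j)‖ ^ 2 * ‖Ψ.ψ X‖ ^ 2)) *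
          (4 * (∫ X in cellN (n + 1) L,
                  ‖∑ j : Fin (n + 1), cellWave L m (X j) *
                      fderiv ℝ Ψ.ψ X (Pi.single j ((2 * Real.pi / L) • latticeVec 1 m))‖ ^ 2) +
            ((n : ℝ) + 1) * ‖(2 * Real.pi / L) • latticeVec 1 m‖ ^ 4 *
              (2 - ((n : ℝ) + 1)⁻¹ *
                ∫ X in cellN (n + 1) L,
                  ‖∑ j : Fin (n + 1), cellWave L m (X j)‖ ^ 2 * ‖Ψ.ψ X‖ ^ 2))

/-- The reality-free form implies the stub as typed. [folklore] -/
theorem secondMomentFloorExact_of_withoutReality (h : SecondMomentFloorWithoutReality) :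
    SecondMomentFloorExact :=
  fun n L hL Ψ _ m hm => h n L hL Ψ m hm

/-- **S1 without the reality hypothesis is FALSE**: at `n + 1 = 2`, `L = 1`, `m = e₀` the boosted
anti-correlated pair state `boostState` has `D = 0` and `∫|ρ_kΨ|² = 2/3`, so the asserted inequality
reads `(2K)² ≤ (2/3)·(2K²·5/3) = 20K²/9`, `K = 4π²` — absurd. [folklore] -/
theorem not_secondMomentFloorWithoutReality : ¬ SecondMomentFloorWithoutReality := by
  intro h
  have key := h 1 1 one_pos (boostState one_pos) e0 e0_ne_zero
  have hD : (∫ X in cellN (1 + 1) 1, ‖∑ j : Fin (1 + 1), cellWave 1 e0 (X j) *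
      fderiv ℝ (boostState one_pos).ψ X (Pi.single j ((2 * Real.pi / 1) • latticeVec 1 e0))‖ ^ 2) = 0 :=
    forceStructure_boostFun (L := 1)
  have hS : (∫ X in cellN (1 + 1) 1, ‖∑ j : Fin (1 + 1), cellWave 1 e0 (X j)‖ ^ 2 *
      ‖(boostState one_pos).ψ X‖ ^ 2) = 2 / 3 :=
    structureIntegral_boostFun one_pos
  have hK : ‖(2 * Real.pi / 1) • latticeVec 1 e0‖ = 2 * Real.pi / 1 := norm_kvec one_pos
  rw [hD, hS, hK] at key
  push_cast at key
  nlinarith [key, pow_pos Real.pi_pos 4]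

end Summit.AtomisticToContinuum.BoseEinsteinCondensation.Theorems.HardCoreExtension.Negative
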